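import Summits.NavierStokesRegularity.NavierStokesRegularity.Theorems.ScaledTopAlignmentTypeIBlowupBudgetPortrait
import Summits.NavierStokesRegularity.NavierStokesRegularity.Theorems.ScaledTopAlignmentMostTimesWindowAt
import Summits.NavierStokesRegularity.NavierStokesRegularity.Theorems.IsobarTomographyTubeAlternativeStubTwoSidedVorticityRate
import HarnessLib

/-!
# Route `ScaledTopAlignment`, crux W3ᵐᵗ = `AprioriMostTimesBulkAlignment` (stmt-NavierStokesRegularity-19551),
# registered line `nearmax` (open stub `stub_nearMaxMostTimes`): the Type-I blow-up portrait of the VOLUME currency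
# AT EVERY POINT — near a Type-I singular time EVERY rate-near-maximal window carries a uniform misaligned bulk

The tree's Type-I portraits in the window/volume currency of the doors W3ʷᵇ / W3ᵐᵗ / W3ⁿᵐ
(`persistent_misaligned_nearMax_windows_of_typeI_blowup`, `omnidirectionally_misaligned_nearMax_windows_of_typeI_blowup`)
assert that at every late time SOME point carries a misaligned near-max window — the Type-I zooms that prove them
place their centres at Leray near-maximum points of the velocity. With the zoom at CALLER-CHOSEN points
(`typeIZoom_vorticity_at_points`, `ScaledTopAlignmentTypeIZoomAtPoints`) and the tree's window lemma with the door read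
only at the preimages of the base point (`exists_window_cross_eq_zero_of_windowBulkAligned_at`,
`ScaledTopAlignmentMostTimesWindowAt`) the portrait holds at EVERY rate point, with constants uniform over points and
late times:

* `typeI_uniform_window_bulk_misalignment` — for `ν > 0`, a classical Leray–Hopf solution from a rapidly decaying
  datum with the Type-I rate at `T`, and every `κ > 0`, `λ₀ < 1`, `R₀ > 0`: there are `ε > 0`, `δ > 0` and `t₁ < T`
  such that for ALL `t ∈ [t₁, T)` and ALL `x` with `κ/(T − t) ≤ |ω(t,x)|`, the `ε`-misaligned (sign-blind sine
  against `ξ(t,x)`) part of the `λ₀`-relative top set inside the window `|x − y| ≤ R₀ℓ`, `ℓ = √(ν/|ω(t,x)|)`, has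
  volume `> δℓ³` — verbatim the NEGATION of the window clause of W3ⁿᵐ / of the planner's law UAW, at every late
  rate point. Proof: violating points with `ε_n = δ_n = 1/(n+1)`; zoom at them; the violation feeds the window
  lemma at the base point `0` (levels `M_j = 0`); the limit profile has an aligned window around `0` and a
  non-zero vorticity there (`κ`-floor), contradicting the aligned-window rigidity `eq_zero_of_aligned_window`.
  No singularity hypothesis is needed.
* `typeI_uniform_nearMax_window_bulk_misalignment` — the same at every RELATIVE near-maximum
  `λ₀ sup_z|ω(t,z)| ≤ |ω(t,x)|` (the cell's DIRCOH/NEARMAX statistics read exactly these points), for a maximal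
  solution (`¬ HasSmoothExtensionPast`, used through the lower Type-I vorticity rate).

WHAT THIS IS NOT: not NS regularity, nothing about Type II, not a proof of the stub: necessary conditions on
hypothetical Type-I singular windows (under the route's residual NoTypeII every first singularity is of this kind);
`ε, δ` come from compactness and are not explicit. [folklore]

## References
* Y. Giga, H. Miura, Comm. Math. Phys. 303 (2011) 289–300 = HUPS #956, Thm 1.1, §2.1. [GigaMiura2011]
* G. Koch, N. Nadirashvili, G. Seregin, V. Šverák, Acta Math. 203 (2009) = arXiv:0709.3599, Prop. 4.1, Lemma 6.1,
  §6. [KochNadirashviliSereginSverak2009]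
-/

noncomputable section

-- the summit and its single sub-problem share the name (CONVENTIONS §1), as in every Theorems file
set_option linter.dupNamespace false

open Set Function Filter Topology Metric MeasureTheory
open scoped RealInnerProductSpace ENNReal
open Literature.Analysis Literature.Analysis.FluidPDE
open Summit.NavierStokesRegularity.NavierStokesRegularity.Theorems.LocalSineTubeDoorProfileAlignedWindowRigidity

namespace Summit.NavierStokesRegularity.NavierStokesRegularity.Theorems

/-! ### Every rate-near-maximal window carries a uniform misaligned bulk -/

/-- **Type-I blow-up portrait, volume currency, at every rate point.** For `ν > 0`, `T > 0`, a classical solution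
`(u, p)` on `ℝ³ × [0, T)`, Leray–Hopf from its rapidly decaying datum `u 0`, with the Type-I rate at `T`, and every
`κ > 0`, `λ₀ < 1`, `R₀ > 0`: there are `ε > 0`, `δ > 0`, `t₁ ∈ [0, T)` such that for all `t ∈ [t₁, T)` and all `x`
with `κ/(T − t) ≤ |ω(t,x)|`,
`δ ℓ³ < vol {y : λ₀|ω(t,x)| ≤ |ω(t,y)|, |x − y| ≤ R₀ℓ, ε < sin∠(ξ(t,x), ξ(t,y))}`, `ℓ = √(ν/|ω(t,x)|)`.
Zoom at the violating points (`typeIZoom_vorticity_at_points`), window lemma at the base point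
(`exists_window_cross_eq_zero_of_windowBulkAligned_at`), aligned-window rigidity (`eq_zero_of_aligned_window`).
[cite: GigaMiura2011, Thm 1.1 and §2.1 (HUPS preprint #956); KochNadirashviliSereginSverak2009, §6 Lemma 6.1] -/
theorem typeI_uniform_window_bulk_misalignment {ν T : ℝ} (hν : 0 < ν) (hT : 0 < T)
    {u : ℝ → EuclideanSpace ℝ (Fin 3) → EuclideanSpace ℝ (Fin 3)} {p : ℝ → EuclideanSpace ℝ (Fin 3) → ℝ}
    (hsol : IsClassicalNSSolutionOn (Ico 0 T) ν 0 u p) (hLH : IsLerayHopfOn T ν 0 (u 0) u)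
    (hdec : HasRapidSpatialDecay (u 0)) (hI : IsTypeIBlowup u T)
    {κ lam0 R0 : ℝ} (hκ : 0 < κ) (hlam1 : lam0 < 1) (hR0 : 0 < R0) :
    ∃ ε : ℝ, 0 < ε ∧ ∃ δ : ℝ, 0 < δ ∧ ∃ t₁ ∈ Ico 0 T, ∀ t ∈ Ico t₁ T, ∀ x : EuclideanSpace ℝ (Fin 3),
      κ / (T - t) ≤ ‖curl (u t) x‖ →
        ENNReal.ofReal (δ * Real.sqrt (ν / ‖curl (u t) x‖) ^ 3) <
          volume {y : EuclideanSpace ℝ (Fin 3) | lam0 * ‖curl (u t) x‖ ≤ ‖curl (u t) y‖ ∧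
              ‖x - y‖ ≤ R0 * Real.sqrt (ν / ‖curl (u t) x‖) ∧
              ε < Real.sqrt (1 - (inner ℝ (‖curl (u t) x‖⁻¹ • curl (u t) x)
                (‖curl (u t) y‖⁻¹ • curl (u t) y)) ^ 2)} := by
  by_contra hcon
  push Not at hcon
  -- ## violating rate points at every level `1/(n+1)`, at times `≥ T - T/(n+2)`
  set τ₀ : ℕ → ℝ := fun n => T - T / ((n : ℝ) + 2) with hτ₀def
  have hτ₀ : ∀ n, τ₀ n ∈ Ico 0 T := fun n => by
    have h2 : (0 : ℝ) < (n : ℝ) + 2 := by positivity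
    have h3 : T / ((n : ℝ) + 2) ≤ T := by
      rw [div_le_iff₀ h2]; nlinarith [(Nat.cast_nonneg n : (0 : ℝ) ≤ n)]
    have h4 : 0 < T / ((n : ℝ) + 2) := div_pos hT h2
    simp only [hτ₀def, mem_Ico]
    constructor <;> linarith
  choose t ht x hx hle using fun n : ℕ =>
    hcon (1 / ((n : ℝ) + 1)) (by positivity) (1 / ((n : ℝ) + 1)) (by positivity) (τ₀ n) (hτ₀ n)
  have htI : ∀ n, t n ∈ Ico 0 T := fun n => ⟨(hτ₀ n).1.trans (ht n).1, (ht n).2⟩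
  have hTt : ∀ n, 0 < T - t n := fun n => sub_pos.2 (ht n).2
  have htT : Tendsto t atTop (𝓝 T) := by
    have h0 : Tendsto τ₀ atTop (𝓝 T) := by
      have h1 : Tendsto (fun n : ℕ => T / ((n : ℝ) + 2)) atTop (𝓝 0) := by
        have h := tendsto_const_div_atTop_nhds_zero_nat T
        have h' : Tendsto (fun n : ℕ => T / ((↑(n + 2) : ℝ))) atTop (𝓝 0) :=
          h.comp (tendsto_add_atTop_nat 2)
        refine h'.congr fun n => ?_
        push_cast; ring_nf
      have := h1.const_sub T
      simpa only [hτ₀def, sub_zero] using this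
    refine tendsto_of_tendsto_of_tendsto_of_le_of_le h0 tendsto_const_nhds (fun n => (ht n).1)
      fun n => (ht n).2.le
  -- ## the Type-I zoom at the violating points
  have hslab : ∀ T' < T, ∃ M : ℝ, ∀ s ∈ Icc 0 T', ∀ y, ‖u s y‖ ≤ M := by
    have key : ∀ T' ∈ Ioo 0 T, ∃ M : ℝ, ∀ s ∈ Icc 0 T', ∀ y, ‖u s y‖ ≤ M := fun T' hT' => by
      obtain ⟨B, -, hB⟩ := iteratedFDeriv_slab_bound_of_lerayHopf hν hsol hLH hdec hT' 0
      exact ⟨B, fun s hs y => by simpa only [norm_iteratedFDeriv_zero] using hB s hs y⟩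
    intro T' hT'
    by_cases h : 0 < T'
    · exact key T' ⟨h, hT'⟩
    · obtain ⟨M, hM⟩ := key (T / 2) ⟨by linarith, by linarith⟩
      push Not at h
      exact ⟨M, fun s hs y => hM s ⟨hs.1, by linarith [hs.2]⟩ y⟩
  obtain ⟨φ, hφ, C, W, lam, hW, hlam, hlam2, hlam0, hslice, hlu, -⟩ :=
    typeIZoom_vorticity_at_points hν hT hsol hLH hslab hI htI htT x
  have hφt : Tendsto φ atTop atTop := hφ.tendsto_atTop
  -- the limit vorticity slice `Ω = curl W(-1)` and the pointwise convergence of the vorticity zooms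
  set Ω : EuclideanSpace ℝ (Fin 3) → EuclideanSpace ℝ (Fin 3) := curl (W (-1)) with hΩ
  have hΩc : Continuous Ω := (contDiff_curl_slice_of_isTypeIAncientMild hW (by norm_num)).continuous
  have hconv : ∀ y, Tendsto (fun j => (lam j ^ 2 / ν) • curl (u (t (φ j))) (x (φ j) + lam j • y)) atTop
      (𝓝 (Ω y)) := by
    intro y
    have h := (hlu (-1) (by norm_num)).tendstoLocallyUniformlyOn.tendsto_at (mem_univ y)
    simp only [hslice] at h
    exact h
  -- the limit amplitude at the origin (rate floor, scale invariant)
  have hκZ : ∀ j, κ ≤ ‖(lam j ^ 2 / ν) • curl (u (t (φ j))) (x (φ j) + lam j • (0 : EuclideanSpace ℝ (Fin 3)))‖ :=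
    fun j => by
    rw [smul_zero, add_zero, norm_smul, Real.norm_of_nonneg (by positivity : (0 : ℝ) ≤ lam j ^ 2 / ν), hlam2 j]
    have hTt' := hTt (φ j)
    have h1 : ν * (T - t (φ j)) / ν * (κ / (T - t (φ j))) = κ := by field_simp
    calc κ = ν * (T - t (φ j)) / ν * (κ / (T - t (φ j))) := h1.symm
      _ ≤ ν * (T - t (φ j)) / ν * ‖curl (u (t (φ j))) (x (φ j))‖ :=
          mul_le_mul_of_nonneg_left (hx (φ j)) (by positivity)
  have hκΩ : κ ≤ ‖Ω 0‖ := ge_of_tendsto (hconv 0).norm (Eventually.of_forall fun j => hκZ j)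
  have hΩ0 : Ω 0 ≠ 0 := norm_pos_iff.1 (hκ.trans_le hκΩ)
  -- ## the window clause at the base point `0` of the zooms, from the violations
  have hWin : ∀ ε : ℝ, 0 < ε → ∀ δ : ℝ, 0 < δ → ∃ Ms : ℕ → ℝ,
      Tendsto (fun j => Ms j * lam j ^ 2) atTop (𝓝 0) ∧ ∀ᶠ j in atTop,
      Ms j ≤ ‖curl (u (t (φ j))) (x (φ j) + lam j • (0 : EuclideanSpace ℝ (Fin 3)))‖ →
        volume {y : EuclideanSpace ℝ (Fin 3) |
            lam0 * ‖curl (u (t (φ j))) (x (φ j) + lam j • (0 : EuclideanSpace ℝ (Fin 3)))‖ ≤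
              ‖curl (u (t (φ j))) y‖ ∧
            ‖(x (φ j) + lam j • (0 : EuclideanSpace ℝ (Fin 3))) - y‖ ≤
              R0 * Real.sqrt (ν / ‖curl (u (t (φ j))) (x (φ j) + lam j • (0 : EuclideanSpace ℝ (Fin 3)))‖) ∧
            ε < Real.sqrt (1 - (inner ℝ
              (‖curl (u (t (φ j))) (x (φ j) + lam j • (0 : EuclideanSpace ℝ (Fin 3)))‖⁻¹ •
                curl (u (t (φ j))) (x (φ j) + lam j • (0 : EuclideanSpace ℝ (Fin 3))))
              (‖curl (u (t (φ j))) y‖⁻¹ • curl (u (t (φ j))) y)) ^ 2)}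
          ≤ ENNReal.ofReal (δ * Real.sqrt (ν /
            ‖curl (u (t (φ j))) (x (φ j) + lam j • (0 : EuclideanSpace ℝ (Fin 3)))‖) ^ 3) := by
    intro ε hε δ hδ
    refine ⟨fun _ => 0, by simp, ?_⟩
    -- eventually `1/(φ j + 1) ≤ min ε δ`
    have hsmall : ∀ᶠ j in atTop, 1 / ((φ j : ℝ) + 1) < min ε δ :=
      (tendsto_one_div_add_atTop_nhds_zero_nat.comp hφt).eventually_lt_const (lt_min hε hδ)
    filter_upwards [hsmall] with j hj _
    simp only [smul_zero, add_zero]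
    have hjε : 1 / ((φ j : ℝ) + 1) < ε := hj.trans_le (min_le_left _ _)
    have hjδ : 1 / ((φ j : ℝ) + 1) ≤ δ := (hj.trans_le (min_le_right _ _)).le
    calc volume {y : EuclideanSpace ℝ (Fin 3) | lam0 * ‖curl (u (t (φ j))) (x (φ j))‖ ≤ ‖curl (u (t (φ j))) y‖ ∧
            ‖x (φ j) - y‖ ≤ R0 * Real.sqrt (ν / ‖curl (u (t (φ j))) (x (φ j))‖) ∧
            ε < Real.sqrt (1 - (inner ℝ (‖curl (u (t (φ j))) (x (φ j))‖⁻¹ • curl (u (t (φ j))) (x (φ j)))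
              (‖curl (u (t (φ j))) y‖⁻¹ • curl (u (t (φ j))) y)) ^ 2)}
        ≤ volume {y : EuclideanSpace ℝ (Fin 3) | lam0 * ‖curl (u (t (φ j))) (x (φ j))‖ ≤ ‖curl (u (t (φ j))) y‖ ∧
            ‖x (φ j) - y‖ ≤ R0 * Real.sqrt (ν / ‖curl (u (t (φ j))) (x (φ j))‖) ∧
            1 / ((φ j : ℝ) + 1) < Real.sqrt (1 - (inner ℝ (‖curl (u (t (φ j))) (x (φ j))‖⁻¹ •
              curl (u (t (φ j))) (x (φ j))) (‖curl (u (t (φ j))) y‖⁻¹ • curl (u (t (φ j))) y)) ^ 2)} :=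
          measure_mono fun y hy => ⟨hy.1, hy.2.1, hjε.trans hy.2.2⟩
      _ ≤ ENNReal.ofReal (1 / ((φ j : ℝ) + 1) * Real.sqrt (ν / ‖curl (u (t (φ j))) (x (φ j))‖) ^ 3) :=
          hle (φ j)
      _ ≤ ENNReal.ofReal (δ * Real.sqrt (ν / ‖curl (u (t (φ j))) (x (φ j))‖) ^ 3) :=
          ENNReal.ofReal_le_ofReal (mul_le_mul_of_nonneg_right hjδ (pow_nonneg (Real.sqrt_nonneg _) 3))
  -- ## an aligned window of the limit profile around the origin
  obtain ⟨U, hUo, h0U, hal⟩ := exists_window_cross_eq_zero_of_windowBulkAligned_at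
    (ω := fun s z => curl (u s) z) (xc := fun j => x (φ j)) (t := fun j => t (φ j)) (y₀ := 0)
    hν hlam1 hR0 hlam hWin hΩc hconv hΩ0
  -- ## the aligned-window rigidity forces the limit profile to vanish
  have hmildW : ∀ s' s : ℝ, s' < s → s < 0 → ∀ y : EuclideanSpace ℝ (Fin 3),
      W s y = UnboundedOperators.heatExtension (W s') (s - s') y - oseenDuhamel 1 s' W W s y :=
    fun s' s hst hs y => hW.mild_eq_heatExtension hst hs y
  have hWzero : ∀ s < 0, ∀ y, W s y = 0 :=
    eq_zero_of_aligned_window hW.hasTypeITimeDecay hW.continuousOn_uncurry hmildW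
      (fun s hs => hW.isDivFree hs) (by norm_num : (-1 : ℝ) < 0) hΩ0 hUo ⟨0, h0U⟩ hal
  have hWs : W (-1) = fun _ => (0 : EuclideanSpace ℝ (Fin 3)) := funext fun y => hWzero (-1) (by norm_num) y
  have hΩ0' : Ω 0 = 0 := by
    rw [hΩ]
    apply curl_eq_zero_of_fderiv_eq_zero
    rw [hWs]
    simp
  exact hΩ0 hΩ0'

/-- **The same at every RELATIVE near-maximum** (the points the cell's DIRCOH / NEARMAX statistics read): for a
classical Leray–Hopf solution from a rapidly decaying datum with the Type-I rate at `T` and no smooth extension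
past `T`, and `0 < λ₀ < 1`, `R₀ > 0`: uniform `ε, δ > 0` and `t₁ < T` such that every `(t, x)`, `t ∈ [t₁, T)`, with
`λ₀ sup_z|ω(t,z)| ≤ |ω(t,x)|` has an `ε`-misaligned `λ₀`-top part of its `R₀ℓ`-window of volume `> δℓ³`. A relative
near-maximum is a rate point by the lower Type-I vorticity rate (`lower_vorticity_rate`; the slice supremum is a
true supremum by `upper_vorticity_rate`). [folklore] -/
theorem typeI_uniform_nearMax_window_bulk_misalignment {ν T : ℝ} (hν : 0 < ν) (hT : 0 < T)
    {u : ℝ → EuclideanSpace ℝ (Fin 3) → EuclideanSpace ℝ (Fin 3)} {p : ℝ → EuclideanSpace ℝ (Fin 3) → ℝ}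
    (hsol : IsClassicalNSSolutionOn (Ico 0 T) ν 0 u p) (hLH : IsLerayHopfOn T ν 0 (u 0) u)
    (hdec : HasRapidSpatialDecay (u 0)) (hI : IsTypeIBlowup u T) (hext : ¬ HasSmoothExtensionPast ν 0 u T)
    {lam0 R0 : ℝ} (hlam0 : 0 < lam0) (hlam1 : lam0 < 1) (hR0 : 0 < R0) :
    ∃ ε : ℝ, 0 < ε ∧ ∃ δ : ℝ, 0 < δ ∧ ∃ t₁ ∈ Ico 0 T, ∀ t ∈ Ico t₁ T, ∀ x : EuclideanSpace ℝ (Fin 3),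
      lam0 * (⨆ z, ‖curl (u t) z‖) ≤ ‖curl (u t) x‖ →
        ENNReal.ofReal (δ * Real.sqrt (ν / ‖curl (u t) x‖) ^ 3) <
          volume {y : EuclideanSpace ℝ (Fin 3) | lam0 * ‖curl (u t) x‖ ≤ ‖curl (u t) y‖ ∧
              ‖x - y‖ ≤ R0 * Real.sqrt (ν / ‖curl (u t) x‖) ∧
              ε < Real.sqrt (1 - (inner ℝ (‖curl (u t) x‖⁻¹ • curl (u t) x)
                (‖curl (u t) y‖⁻¹ • curl (u t) y)) ^ 2)} := by
  obtain ⟨Cω, tω, htω, hup⟩ := TubeAlternative.AnalyticPropagation.upper_vorticity_rate hν hT hsol hLH hdec hI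
  obtain ⟨c, hc, tc, htc, hlow⟩ :=
    TubeAlternative.AnalyticPropagation.lower_vorticity_rate hν hT ⟨hsol, hext⟩ hLH hdec hI
  have hκ : 0 < lam0 * c := by positivity
  obtain ⟨ε, hε, δ, hδ, t₁, ht₁, hB⟩ := typeI_uniform_window_bulk_misalignment hν hT hsol hLH hdec hI hκ hlam1 hR0
  set t₂ : ℝ := max (max t₁ tω) tc with ht₂
  have ht₂T : t₂ < T := max_lt (max_lt ht₁.2 htω.2) htc.2
  have ht₂0 : 0 ≤ t₂ := ht₁.1.trans ((le_max_left _ _).trans (le_max_left _ _))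
  refine ⟨ε, hε, δ, hδ, t₂, ⟨ht₂0, ht₂T⟩, fun t ht x hx =>
    hB t ⟨((le_max_left _ _).trans (le_max_left _ _)).trans ht.1, ht.2⟩ x ?_⟩
  have htω' : t ∈ Ico tω T := ⟨((le_max_right _ _).trans (le_max_left _ _)).trans ht.1, ht.2⟩
  have htc' : t ∈ Ico tc T := ⟨(le_max_right _ _).trans ht.1, ht.2⟩
  have hbdd : BddAbove (range fun z => ‖curl (u t) z‖) :=
    ⟨Cω / (T - t), by rintro _ ⟨z, rfl⟩; exact hup t htω' z⟩
  obtain ⟨x', hx'⟩ := hlow t htc'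
  have hsup : c / (T - t) ≤ ⨆ z, ‖curl (u t) z‖ := hx'.trans (le_ciSup hbdd x')
  calc lam0 * c / (T - t) = lam0 * (c / (T - t)) := by ring
    _ ≤ lam0 * ⨆ z, ‖curl (u t) z‖ := mul_le_mul_of_nonneg_left hsup hlam0.le
    _ ≤ ‖curl (u t) x‖ := hx

end Summit.NavierStokesRegularity.NavierStokesRegularity.Theorems

end
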